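import Summits.HodgeConjecture.CorCM.Census.QuarticTwistLaw
import Summits.HodgeConjecture.CorCM.Census.QuarticTwistAll

/-!
# The quartic twist `(ℤ/4 × B, (2,0))`, XIII: THE PARITY-FREE SANDWICH `β − 2 ≤ μ ≤ β − 1` FOR EVERY FINITE `B` WITH `|B| ≥ 3`

COR-CM (cell `pub-hodgecm2`), count-neutral kernel combinatorics by the binder seat b09 (gen 32; lane QUARTIC-TWIST), part XIII, sequel of parts IX
(`QuarticTwistLaw`) and XII (`QuarticTwistAll`).  Theorems only; no new definition, no `decide` table, no certificate, no named fact, no geometry,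
no `sorry`.  HONEST FRAMING: `HC_CM` is NOT proved; nothing here is a headline or a period.

THE PARITY FLOOR (**`card_orb_le_card_add_two`**, every finite `B`, `|B| ≥ 3`).  If a finite family `S` of exponent vectors generates the Hodge
lattice of the quartic twist together with the pairs and all Galois translates, then `β ≤ |S| + 2`: the block parities of part IX without the
Weil vector (whose residual parity is `|B| mod 2`) — one `Φ`-decreasing square per non-residual block, the column face at a constant type and a
Boolean pair difference have independent parities.  With part XII (**`quarticTwist_sandwich`**): for EVERY finite `B` with `|B| ≥ 3` the least
number `μ` of Galois orbits of generators of the Hodge lattice of `(ℤ/4 × B, (2,0))` modulo divisor classes satisfies `β − 2 ≤ μ ≤ β − 1`, the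
upper bound attained by rank-four faces; `μ = β − 1` when `|B|` is odd (part IX).  For `|B|` even neither bound is sharp for all `B` (the
parity image of the Hodge lattice has dimension exactly `β − 2` for every even `|B|`): parts XIV–XV show `μ = β − 2` when `B` has an element of
order divisible by `4` (screw types), parts XVI–XVII show `μ = β − 1` for Hodge generators otherwise (a half-parity functional that is Galois
invariant on Hodge vectors only).  All [folklore].

## References
* [Pohlmann1968] H. Pohlmann, Algebraic cycles on abelian varieties of complex multiplication type, Ann. of Math. 88 (1968), Thm 1.
* [Milne1999] J. S. Milne, Lefschetz motives and the Tate conjecture, Compositio Math. 117 (1999), Prop. 2.1, p. 54.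
-/

namespace Summit.HodgeConjecture.CorCM.Census.QuarticTwist

open Finset

variable (B : Type) [AddGroup B] [Fintype B] [DecidableEq B]

/-- **THE PARITY FLOOR.**  If a finite family `S` of exponent vectors generates the Hodge lattice of the quartic twist together with
the pairs and all Galois translates, then `β ≤ |S| + 2` (every finite `B` with `|B| ≥ 3`; `β = Fintype.card (Orb B)`). [folklore] -/
theorem card_orb_le_card_add_two (h3 : 3 ≤ Fintype.card B) (S : Finset (Ty B → ℤ))
    (hS : hodge B ≤ pairs B ⊔ Submodule.span ℤ {w : Ty B → ℤ | ∃ g : ZMod 4 × B, ∃ v ∈ S, w = transl B g v}) :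
    Fintype.card (Orb B) ≤ S.card + 2 := by
  classical
  obtain ⟨b₀⟩ : Nonempty B := Fintype.card_pos_iff.mp (by omega)
  set T := Submodule.span (ZMod 2) ((S.image (parVec B) : Finset _) : Set (Orb B → ZMod 2)) with hT
  have hT' : Module.finrank (ZMod 2) T ≤ S.card := (finrank_span_finset_le_card _).trans Finset.card_image_le
  -- one `Φ`-decreasing square per non-residual block
  have hsq : ∀ ω : Orb B, ∃ pq : (ZMod 2 × B) × (ZMod 2 × B), ¬ IsRes B ω.out →
      (pq.1.2 ≠ pq.2.2 ∧ Phi B (flip B pq.1 ω.out) < Phi B ω.out ∧ Phi B (flip B pq.2 ω.out) < Phi B ω.out ∧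
        Phi B (flip B pq.2 (flip B pq.1 ω.out)) < Phi B ω.out) := by
    intro ω
    by_cases h : IsRes B ω.out
    · exact ⟨((0, b₀), (0, b₀)), fun h' => (h' h).elim⟩
    · obtain ⟨p, q, hpq⟩ := exists_goodSquare B h3 h
      exact ⟨(p, q), fun _ => hpq⟩
  choose pq hpq using hsq
  -- the residual blocks
  set ωc : Orb B := Quotient.mk (orbitRel B) (atom B 0 b₀ 0) with hωc
  set ωp : Orb B := Quotient.mk (orbitRel B) (atom B 0 b₀ 1) with hωp
  set ωm : Orb B := Quotient.mk (orbitRel B) (atom B 0 b₀ (-1)) with hωm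
  set ω2 : Orb B := Quotient.mk (orbitRel B) (atom B 0 b₀ 2) with hω2
  have n10 : ωp ≠ ωc := mk_atom_ne B h3 b₀ (by decide) (by decide)
  have nm0 : ωm ≠ ωc := mk_atom_ne B h3 b₀ (by decide) (by decide)
  have n20 : ω2 ≠ ωc := mk_atom_ne B h3 b₀ (by decide) (by decide)
  have n1m : ωp ≠ ωm := mk_atom_ne B h3 b₀ (by decide) (by decide)
  have n12 : ωp ≠ ω2 := mk_atom_ne B h3 b₀ (by decide) (by decide)
  have nm2 : ωm ≠ ω2 := mk_atom_ne B h3 b₀ (by decide) (by decide)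
  -- the index type and the vectors
  let NRt := {ω : Orb B // ¬ IsRes B ω.out}
  have resb : ∀ (ω : NRt) (k : ZMod 4), (ω.1 : Orb B) ≠ Quotient.mk (orbitRel B) (atom B 0 b₀ k) := by
    intro ω k h
    apply ω.2
    have hrel : (orbitRel B).r ω.1.out (atom B 0 b₀ k) := Quotient.exact (by rw [Quotient.out_eq]; exact h)
    exact (isRes_iff_of_rel B hrel).mpr ⟨0, b₀, k, rfl⟩
  let vec : Option (Option NRt) → (Ty B → ℤ) := fun x =>
    match x with
    | none => faceVec B (cst B 0) (0, b₀) (1, b₀)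
    | some none => Xvec B 0 b₀
    | some (some ω) => faceVec B ω.1.out (pq ω.1).1 (pq ω.1).2
  have hvecH : ∀ x, vec x ∈ hodge B := by
    rintro (_ | _ | ω)
    · exact faceVec_mem B _ (fun h => (zero_ne_one (α := ZMod 2)) (congrArg Prod.fst h))
    · exact Xvec_mem B 0 b₀
    · exact faceVec_mem B _ (fun h => (hpq ω.1 ω.2).1 (congrArg Prod.snd h))
  have hmem : ∀ x, parVec B (vec x) ∈ T := fun x => parVec_mem_span_of_mem B S (hS (hvecH x))
  -- values of the three residual parities at the residual blocks, and vanishing at non-residual blocks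
  have vcol : ∀ ω : Orb B, parVec B (vec none) ω = (if ω = ωc then 1 else 0) - (if ω = ωp then 1 else 0) - (if ω = ωm then 1 else 0)
      + (if ω = ω2 then 1 else 0) := fun ω => parVec_colface_apply B b₀ ω
  have vX : ∀ ω : Orb B, parVec B (vec (some none)) ω = (if ω = ωp then 1 else 0) + (if ω = ωm then 1 else 0) - (if ω = ωc then 1 else 0)
      - (if ω = ωc then 1 else 0) := fun ω => parVec_Xvec_apply B b₀ ω
  -- linear independence
  have hli : LinearIndependent (ZMod 2) (fun x => parVec B (vec x)) := by
    rw [Fintype.linearIndependent_iff]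
    intro g hsum
    have heval : ∀ ω : Orb B, g none * parVec B (vec none) ω + (g (some none) * parVec B (vec (some none)) ω
        + ∑ ωn : NRt, g (some (some ωn)) * parVec B (vec (some (some ωn))) ω) = 0 := by
      intro ω
      have h := congrFun hsum ω
      rw [Finset.sum_apply, Fintype.sum_option, Fintype.sum_option] at h
      simpa only [Pi.smul_apply, smul_eq_mul, Finset.sum_apply, Pi.zero_apply] using h
    -- (a) the non-residual coefficients vanish
    have hnr : ∀ ωn : NRt, g (some (some ωn)) = 0 := by
      by_contra hne
      obtain ⟨ω₁, hω₁⟩ := not_forall.mp hne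
      obtain ⟨ω₀, hω₀, hmax⟩ := Finset.exists_max_image (univ.filter fun ωn : NRt => g (some (some ωn)) ≠ 0)
        (fun ωn => Phi B ωn.1.out) ⟨ω₁, mem_filter.mpr ⟨mem_univ _, hω₁⟩⟩
      have hg₀ : g (some (some ω₀)) ≠ 0 := (mem_filter.mp hω₀).2
      have hs₀ : ω₀.1.out ∈ orbSet B ω₀.1 := (mem_orbSet B).mpr (Quotient.out_eq _)
      have hω₀Phi : ∀ s' ∈ orbSet B ω₀.1, Phi B ω₀.1.out ≤ Phi B s' := fun s' hs' => (Phi_eq_of_mem_orbSet B hs₀ hs').le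
      have h := heval ω₀.1
      rw [vcol, vX, if_neg (resb ω₀ 0), if_neg (resb ω₀ 1), if_neg (resb ω₀ (-1)), if_neg (resb ω₀ 2)] at h
      have hterm : ∀ ωn : NRt, g (some (some ωn)) * parVec B (vec (some (some ωn))) ω₀.1
          = if ωn = ω₀ then g (some (some ω₀)) else 0 := by
        intro ωn
        by_cases hgn : g (some (some ωn)) = 0
        · rw [hgn, zero_mul]; split_ifs with h' <;> [rw [← h', hgn]; rfl]
        · have hle : Phi B ωn.1.out ≤ Phi B ω₀.1.out := hmax ωn (mem_filter.mpr ⟨mem_univ _, hgn⟩)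
          obtain ⟨-, q1, q2, q12⟩ := hpq ωn.1 ωn.2
          have hφ : ∀ s' ∈ orbSet B ω₀.1, Phi B ωn.1.out ≤ Phi B s' := fun s' hs' => hle.trans (hω₀Phi s' hs')
          rw [show vec (some (some ωn)) = faceVec B ωn.1.out (pq ωn.1).1 (pq ωn.1).2 from rfl,
            parVec_goodSquare B q1 q2 q12 ω₀.1 hφ]
          by_cases hωω : ωn = ω₀
          · subst hωω; rw [if_pos hs₀, if_pos rfl, mul_one]
          · have hnot : ωn.1.out ∉ orbSet B ω₀.1 := by
              intro hin
              exact hωω (Subtype.ext (((mem_orbSet B).mp hin).symm ▸ (Quotient.out_eq ωn.1).symm ▸ rfl))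
            rw [if_neg hnot, if_neg hωω, mul_zero]
      rw [Finset.sum_congr rfl (fun ωn _ => hterm ωn), Finset.sum_ite_eq' univ ω₀, if_pos (mem_univ _)] at h
      simp only [mul_zero, sub_self, add_zero, zero_add] at h
      exact hg₀ h
    have hrest : ∀ ω : Orb B, g none * parVec B (vec none) ω + g (some none) * parVec B (vec (some none)) ω = 0 := by
      intro ω
      have h := heval ω
      rw [Finset.sum_eq_zero (fun ωn _ => by rw [hnr ωn, zero_mul]), add_zero] at h
      exact h
    -- (b) evaluate at the blocks of `2δ`, `+δ`
    have e2 : g none = 0 := by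
      have h := hrest ω2
      rw [vcol, vX] at h
      simpa [n20, n12.symm, nm2.symm] using h
    have ep : g (some none) = 0 := by
      have h := hrest ωp
      rw [vcol, vX, e2] at h
      simpa [n10, n1m, n12] using h
    rintro (_ | _ | ω)
    · exact e2
    · exact ep
    · exact hnr ω
  -- count
  have hli' : LinearIndependent (ZMod 2) (fun x => (⟨_, hmem x⟩ : T)) := LinearIndependent.of_comp T.subtype hli
  have hcard := hli'.fintype_card_le_finrank
  simp only [Fintype.card_option] at hcard
  have hNR : Fintype.card NRt = (univ.filter fun ω : Orb B => ¬ IsRes B ω.out).card := Fintype.card_subtype _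
  have hres : (univ.filter fun ω : Orb B => IsRes B ω.out).card ≤ 4 := by
    have hsub : (univ.filter fun ω : Orb B => IsRes B ω.out) ⊆ {ωc, ωp, ωm, ω2} := by
      intro ω hω
      obtain ⟨u, b, k, hk⟩ := (mem_filter.mp hω).2
      have hω' : ω = Quotient.mk (orbitRel B) (atom B 0 b₀ k) := by rw [← Quotient.out_eq ω, hk, mk_atom_eq B b₀]
      simp only [mem_insert, mem_singleton]
      have key : ∀ k : ZMod 4, k = 0 ∨ k = 1 ∨ k = -1 ∨ k = 2 := by decide
      rcases key k with rfl | rfl | rfl | rfl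
      · exact Or.inl hω'
      · exact Or.inr (Or.inl hω')
      · exact Or.inr (Or.inr (Or.inl hω'))
      · exact Or.inr (Or.inr (Or.inr hω'))
    exact (Finset.card_le_card hsub).trans Finset.card_le_four
  have htot := Finset.card_filter_add_card_filter_not (s := (univ : Finset (Orb B))) (fun ω : Orb B => IsRes B ω.out)
  rw [Finset.card_univ] at htot
  omega

/-- **THE PARITY-FREE SANDWICH** (every finite `B`, `|B| ≥ 3`).  (i) `β − 1` rank-four faces generate the Hodge lattice of the quartic twist
modulo the pairs together with their Galois translates, and (ii) no family of fewer than `β − 2` exponent vectors of any kind does: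
`β − 2 ≤ μ(ℤ/4 × B) ≤ β − 1`. [folklore] -/
theorem quarticTwist_sandwich (h3 : 3 ≤ Fintype.card B) :
    (∃ S : Finset (Ty B × (ZMod 2 × B) × (ZMod 2 × B)), (∀ f ∈ S, f.2.1 ≠ f.2.2) ∧ hodge B ≤ pairs B ⊔ spanFaces B S ∧
        S.card + 1 = Fintype.card (Orb B)) ∧
      ∀ S : Finset (Ty B → ℤ),
        hodge B ≤ pairs B ⊔ Submodule.span ℤ {w : Ty B → ℤ | ∃ g : ZMod 4 × B, ∃ v ∈ S, w = transl B g v} →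
        Fintype.card (Orb B) ≤ S.card + 2 :=
  ⟨exists_faces_generate_all B h3, fun S hS => card_orb_le_card_add_two B h3 S hS⟩

end Summit.HodgeConjecture.CorCM.Census.QuarticTwist
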